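import Summits.QuantumFields.YangMills.Theorems.BalabanUVNodesN05SubBP2DSlotExistsOfThm33JunctionH
import Literature.MathematicalPhysics.QuantumFieldTheory.Balaban1983to89.B8TowerBondsLayerLawSubD

/-!
# BalabanUVNodes ∕ N05 ([Balaban1985RegularSpaces] Lemma 1 p. 79 – Thm 8 p. 101): THE J-N06→N05 JUNCTION APPLIED ON THE «P₂D» ROAD WITH THE GENUINE AVERAGING LETTER —
# `BalabanUVNodesN05SubBP2DSlotExistsOfThm33JunctionH` with the averaging binder `havg` DISCHARGED by name (dag-n05-w2's (1.31)-class law on `Node00.IdxB8SubD θ`,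
# dag-n06-b's `avgAtP_withQQP`), the letter `ops` pinned pointwise to `withQQP τ θ.L (print's class of the member) ops₀` and `q := qQ θ.D θ.L C_τ β_τ 1`

Track A of `YM-PLAN.md` (cell `pub-ymgap`, HUMAN RULING D-0062), node **N05** = [Balaban1985RegularSpaces] («B8»), in-edge **N06** = [Balaban1985BackgroundPropagators]
(«B9», print's ref. [4]); seat `pub-ymgap-dag-n05-d` (g13), 2026-08-28; bears on K1⁹ `stmt-QuantumFields-27364` (`--supports … --as helper`, count-neutral).

WHY.  Of the ten junction binders displayed by `exists_residB8_b8LeafOfRecordSubBP₂D_cutSubBP₅_of_letters_thm33_junctionH`, the averaging one — `havg : AvgAtP θ.L ops q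
(fun m′ l => towerBondsP θ.L j.Ω (j.Λs m′) l) M j m` ([4] (3.16): the co-letter `(Q*Q)(U₀)A` of the source `J̃ = Δ_a(U₀)A` is bounded by `q·|B₁|` over print's class (1.31)) —
is a THEOREM of the tree once the letter is the genuine one: dag-n06-b's `B9Eq316AveragingTransposeZdPrinted.avgAtP_withQQP` gives it for the letter family `withQQP τ L ΛbP
ops₀` at any class `ΛbP` obeying the box law `LevelSepPP L m Ω ΛbP 1`, and dag-n05-w2's `B8TowerBondsLayerLawSubD.IdxB8SubD.levelSepPP_towerBondsP` proves that law OUTRIGHT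
at every (1.3)–(1.5)-admissible member and every truncation `m ≤ k` (offer (o1) of the cell bus 2026-08-28, answered «n05-d inline» by dag-n05-w2).  So the N05 row needs
NINE junction binders + [4]'s letters + N06's `B9.Thm33Printed`, with `ops M i m = withQQP τ θ.L (towerBondsP-class of i) ops₀ M i m` displayed pointwise (`hops`; a
consumer instantiates `ops :=` that lambda and `hops := fun _ _ _ => rfl`) and the (3.16) constant pinned to `qQ θ.D θ.L C_τ β_τ 1` (`τ` a trace-like functional with
`|Re τ(x*y)| ≤ C_τ‖x‖‖y‖`; `θ.𝔸` finite-dimensional over `ℝ`, as print's `M_N(ℂ)`).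

WHAT IS PROVED (one theorem + one private bookkeeping lemma; no estimate; no new definition):
* ★★★ **`exists_residB8_b8LeafOfRecordSubBP₂D_cutSubBP₅_of_letters_thm33_junctionH_withQQP`** — the companion theorem with `havg` removed, `q := qQ θ.D θ.L C_τ β_τ 1`,
  and the pointwise pin `hops`; proof: ONE application of the companion with `havg := avgAtP_withQQP ∘ IdxB8SubD.levelSepPP_towerBondsP` (through `hops`).
HONEST FRAMING: CLASS NOTE (dag-n05-w2's LOCATED-PRINT-CLASS, cell bus 2026-08-28): the binders range over ALL `IdxB8SubD` members — wider than
print's (1.4) regime «M ≥ M₁, R large» — so AS TYPED they are stronger-than-print hypotheses at the minimal-margin towers; the planned exit is ONE `Subtype` cut to the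
class `κ` the first class-wide N06 supplier names (dag-n05-c (E2)); every statement here stays true under that cut.  by-name composition; 0 estimates; the displayed [4] letters, `Thm33Printed` and the nine junction binders are HYPOTHESES (N06's object layer on `ℤᵈ`, m ≥ 1
OPEN; class-wide satisfiability NOT claimed; no positive A6 witness claimed); Proposition 7 in the repaired currency (WATCH-P7-CURRENCY-RECORD); count-neutral; **N05 NOT
discharged**; K1⁸ NOT claimed; Bałaban AS PRINTED; one finite 𝕋⁴ programme at fixed ε; nothing continuum ∕ ℝ⁴ ∕ OS ∕ mass-gap ∕ Clay.  No `sorry`, no new definition.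
Unit `pub-ymgap-dag-n05-d` (g13).
[cite: Balaban1985RegularSpaces, Lemma 1 – Thm 8 pp.79–101, (1.31) p.82, (1.56)–(1.59) p.86, (1.3)–(1.5) p.77; Balaban1985BackgroundPropagators, (3.16) p.393, Thm 3.1 p.397, Thm 3.3 p.399, (3.42)–(3.47) pp.397–398; Balaban1984PropagatorsII, (2.3) p.224]
-/

noncomputable section

namespace Summit.QuantumFields.YangMills.BalabanUVNodes.N05SubBP2DSlotExistsOfThm33JunctionHWithQQP

open Literature.MathematicalPhysics.QuantumFieldTheory.Balaban1983to89
open Literature.MathematicalPhysics.QuantumFieldTheory.Balaban1983to89.Node00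
open Literature.MathematicalPhysics.QuantumFieldTheory.Balaban1983to89.B8IdxB8LawsB (IdxB8LawsB IdxB8SubB)
open Literature.MathematicalPhysics.QuantumFieldTheory.Balaban1983to89.B8LeafModelZd (ZdIdx)
open Literature.MathematicalPhysics.QuantumFieldTheory.Balaban1983to89.B8LeafModelZd3 (SockB9P3)
open Literature.MathematicalPhysics.QuantumFieldTheory.Balaban1983to89.B9SupplySockB9P3ZdGammaUnivDelta2 (SockB9P3H2)
open Literature.MathematicalPhysics.QuantumFieldTheory.Balaban1983to89.B8LeafModelZd3P (zdGF3P zdGF3HP)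
open Literature.MathematicalPhysics.QuantumFieldTheory.Balaban1983to89.B8LeafModelZd3P2 (zdGF3P₂ zdGF3HP₂)
open Literature.MathematicalPhysics.QuantumFieldTheory.Balaban1983to89.B8TowerBondsPrinted (towerBondsP)
open Literature.MathematicalPhysics.QuantumFieldTheory.Balaban1983to89.B8SockLettersRD (SockLettersRD)
open Literature.MathematicalPhysics.QuantumFieldTheory.Balaban1983to89.B8Lemma1NonAbelian (mulCfg blockPairNA)
open Literature.MathematicalPhysics.QuantumFieldTheory.Balaban1983to89.B8LanF146 (LanF146)
open Literature.MathematicalPhysics.QuantumFieldTheory.Balaban1983to89.B8Eq138LandauZd (covLap QT InR138 IsLandau146W)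
open Literature.MathematicalPhysics.QuantumFieldTheory.Balaban1983to89.B8Prop5LandauDataZd (ZdLanIdx zdLan)
open Summit.QuantumFields.YangMills.BalabanUVNodes.N05SubBP2DSlotGammaPrime (b8LeafOfRecordSubBP₂D_cutSubBP_zdLan_printCube_of_knit_lettersSrc_γ')
open Summit.QuantumFields.YangMills.BalabanUVNodes.N05SubBP2CSlotExistsGammaPrime (exists_residB8_layer)
open MatrixLog B7Prop1Explicit B7Prop2Explicit B7Prop1Local B7Eq92Concrete
open B8Ineq130 (tlo thi)
open B8Ineq132 (InAk covDerivFwd)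
open B7Eq78Linearization (zdBlocking QprimeIter)
open B8Eq119TwistedAxial (bgT Restr129 InAx)
open B8Eq140Level (SideTouches)
open B8Eq1117Concrete (XSpace)
open B8Prop5ContractionKLevel (Bd2)
open B8LambdaSpaceKLevel (wt)
open B8Eq184Proof (gaugeExp cfgExp)
open B8Eq146AExpansion (iEta plaqCovDeriv)
open B8Eq143PlaqExpansion (pdiv)
open B7Prop4GeneralLevels (linCovIter)
open B8Eq155JBound (Jcur wsup)
open B8ScaledSupNorm (bondNorm msup Bdd)
open B9Eq340HolderZd (hquot AdmPair)

open B9SupplySockB9P3ZdLetters (OpsZd)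
open B9SupplySockB9P3ZdAt (DictAt Prop6At LandauAt SrcAt)
open B9SupplySockB9P3ZdAtLin (LinBddAt)
open B9SupplySockB9P3ZdGammaUniv (AvgAtP)
open B9SupplySockB9P3ZdGammaInAk (CurvAtInAk)
open B9SupplySockB9P3ZdGammaUnivDelta2 (HolderAtδ2)
open B9SupplySockB9P3ZdAtHerm (InvAtH)
open B9SupplySockB9P3ZdGammaUnivDelta2Src (SrcHolderAtδ2)
open Summit.QuantumFields.YangMills.BalabanUVNodes.N05SubBP2DSlotExistsLawLanGammaPrime (exists_residB8_b8LeafOfRecordSubBP₂D_cutSubBP₅_of_lettersSrc_γ')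
open Summit.QuantumFields.YangMills.BalabanUVNodes.N05JunctionHMemberSuppliers (sockB9P3H2_member_of_junctionH sB9srcHP_member_of_junctionH sH59src_member_of_junctionH)

open B9Eq316AveragingTransposeZd (qQ betaTau alphaQ alphaQ_pos)
open B9Eq316AveragingTransposeZdPrinted (withQQP avgAtP_withQQP)
open B7Prop5GeneralLevels (thetaGen)
open B8TowerBondsLayerLawSubD (IdxB8SubD.levelSepPP_towerBondsP)
open Summit.QuantumFields.YangMills.BalabanUVNodes.N05SubBP2DSlotExistsOfThm33JunctionH (exists_residB8_b8LeafOfRecordSubBP₂D_cutSubBP₅_of_letters_thm33_junctionH)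

-- `Site` alone could resolve to the torus sites of `Setup.lean`; re-export the `ℤ^d` sites of `B7Prop1Explicit`.
export B7Prop1Explicit (Site)

section WithQQP

/-- `q = qQ d L C_τ β_τ 1 ≥ 0` when `C_τ` bounds `|Re τ(x*y)|` (dag-n05-e's `qQ_one_nonneg`, re-proved to keep the import light). [cite: Balaban1985BackgroundPropagators, (3.16) p.393 (bookkeeping)] -/
private theorem qQ_one_nonneg' {d L : ℕ} {𝔸 : Type*} [CStarAlgebra 𝔸] [Nontrivial 𝔸] [FiniteDimensional ℝ 𝔸] (τ : 𝔸 →ₗ[ℂ] ℂ) (hL : 1 ≤ L) {Cτ : ℝ}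
    (hCτ : ∀ x y : 𝔸, |(τ (star x * y)).re| ≤ Cτ * ‖x‖ * ‖y‖) : 0 ≤ qQ d L Cτ (betaTau τ) 1 := by
  have hCτ0 : 0 ≤ Cτ := by
    have h := hCτ 1 1
    simp only [star_one, norm_one, mul_one] at h
    exact (abs_nonneg _).trans h
  have hβ : 0 ≤ betaTau τ := by
    unfold betaTau
    split_ifs
    · exact Finset.sum_nonneg fun i _ => mul_nonneg (norm_nonneg _) (norm_nonneg _)
    · exact le_rfl
  have hθ : 0 ≤ 1 + thetaGen d L (alphaQ d L) := by
    have := alphaQ_pos d hL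
    unfold thetaGen
    positivity
  unfold qQ
  positivity

/-- ★★★ **THE J-N06→N05 JUNCTION APPLIED ON THE «P₂D» ROAD, GENUINE AVERAGING LETTER** — the N05 row `∃ lam c₁ ρ₀, B8LeafOfRecordSubBP₂D θ (lam.cutSubBP₅ c₁ ρ₀)` from
[4]'s letters `SLet ∕ SLetUB`, N06's `B9.Thm33Printed c35 geo bg Gp GA`, and NINE junction dictionary binders at every `j : Node00.IdxB8SubD θ` (no `havg`), the letter
family pinned pointwise to dag-n06-b's `withQQP τ θ.L (towerBondsP-class of the member) ops₀` and `q := qQ θ.D θ.L C_τ β_τ 1`.  Proof: the companion theorem with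
`havg` supplied by `avgAtP_withQQP` at dag-n05-w2's outright class law `IdxB8SubD.levelSepPP_towerBondsP`.  Hypotheses are N06 content; N05 NOT discharged.
[cite: Balaban1985RegularSpaces, Lemma 1 – Thm 8 pp.79–101, (1.31) p.82, (1.3)–(1.5) p.77; Balaban1985BackgroundPropagators, (3.16) p.393, Thm 3.1 p.397, Thm 3.3 p.399] -/
theorem exists_residB8_b8LeafOfRecordSubBP₂D_cutSubBP₅_of_letters_thm33_junctionH_withQQP (θ : Stage3Params) (hD : 2 ≤ θ.D) (hL5 : 5 ≤ θ.L)
    -- [Balaban1985BackgroundPropagators] Thm 3.1's letter bounds and threshold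
    {B₀'H B₂' BG BR cL : ℝ} (hB₀'H : 0 < B₀'H) (hB₂' : 0 ≤ B₂') (hBG : 0 ≤ BG) (hBR : 0 ≤ BR) (hcL : 0 < cL)
    -- [4]'s letters AT THE (1.3)–(1.5)-ADMISSIBLE `Ω₀ = ℤᵈ` LAW MEMBERS (p619291's texts verbatim): existence side and uniqueness side
    (SLet : ∀ i : ZdIdx θ.D θ.L, i.Ω 0 = Set.univ → IdxB8LawsB θ.L i → B8ConstraintBonds.DomainSeq θ.L i.Ω → (∀ l, l < i.k → ∀ z ∈ i.Λs i.k l, ((θ.L : ℤ) ^ l) • z ∈ B8ConstraintBonds.Lam θ.L i.Ω l) → SockLettersRD (𝔸 := θ.𝔸) θ.L BG BR B₀'H B₂' cL i.η i.k i.Ω i.Λs)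
    (SLetUB : ∀ i : ZdIdx θ.D θ.L, i.Ω 0 = Set.univ → IdxB8LawsB θ.L i → B8ConstraintBonds.DomainSeq θ.L i.Ω → (∀ l, l < i.k → ∀ z ∈ i.Λs i.k l, ((θ.L : ℤ) ^ l) • z ∈ B8ConstraintBonds.Lam θ.L i.Ω l) → ∀ α₀ : ℝ, 0 < α₀ → α₀ ≤ cL → ∀ U₀ : Site θ.D → Fin θ.D → θ.𝔸ˣ, (∀ x κ, U₀ x κ ∈ unitaryUnits θ.𝔸) →
      InAk θ.L i.k i.η α₀ i.Ω U₀ →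
      ∃ (g Δ : (Site θ.D → θ.𝔸) →ₗ[ℂ] (Site θ.D → θ.𝔸)) (q : (Site θ.D → θ.𝔸) →ₗ[ℂ] (ℕ → Site θ.D → θ.𝔸))
        (qs : (ℕ → Site θ.D → θ.𝔸) →ₗ[ℂ] (Site θ.D → θ.𝔸)) (Aw c : (ℕ → Site θ.D → θ.𝔸) →ₗ[ℂ] (ℕ → Site θ.D → θ.𝔸))
        (H' : XSpace θ.D i.k θ.𝔸 →ₗ[ℂ] (Site θ.D → θ.𝔸)),
        (∀ x : Site θ.D → θ.𝔸, (∃ C : ℝ, ∀ y, ‖x y‖ ≤ C) → g (Δ x + qs (Aw (q x))) = x) ∧ (∀ φ, qs (c (q (g (g (qs φ))))) = qs φ) ∧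
        (∀ (f : Site θ.D → θ.𝔸), ∀ x ∈ i.Ω 0, Δ f x = covLap i.η U₀ ((i.Ω 0).indicator f) x) ∧
        (∀ (μ : ℕ → Site θ.D → θ.𝔸), ∀ x ∈ i.Ω 0, qs μ x = QT θ.L i.k (i.Λs i.k) U₀ μ x) ∧
        (∀ (f : Site θ.D → θ.𝔸) (n : ℕ), n ≤ i.k → ∀ y ∈ i.Λs i.k n, q f n y = QprimeIter (zdBlocking θ.D θ.L) (bgT θ.L U₀) n f y) ∧
        (∀ (f : Site θ.D → θ.𝔸) (n : ℕ) (y : Site θ.D), ¬ (n ≤ i.k ∧ y ∈ i.Λs i.k n) → q f n y = 0) ∧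
        (∀ (X : XSpace θ.D i.k θ.𝔸) (x : Site θ.D), ‖H' X x‖ ≤ B₀'H * ‖X‖) ∧
        (∀ n, n ≤ i.k → ∀ (X : XSpace θ.D i.k θ.𝔸), ∀ p ∈ {b : Site θ.D × Fin θ.D | SideTouches (i.Ω n) b.1 b.2},
          wt θ.L i.η n * ‖covDerivFwd i.η U₀ p.2 (H' X) p.1‖ ≤ B₀'H * ‖X‖) ∧
        (∀ X : XSpace θ.D i.k θ.𝔸, Bd2 θ.L i.η i.k i.Ω (covLap i.η U₀ (H' X)) (B₂' * ‖X‖)) ∧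
        (∀ (Y : XSpace θ.D i.k θ.𝔸) (n : ℕ) (hn : n ≤ i.k) (y : Site θ.D), y ∈ i.Λs i.k n →
          QprimeIter (zdBlocking θ.D θ.L) (bgT θ.L U₀) n (H' Y) y = Y (⟨n, Nat.lt_succ_of_le hn⟩, y)) ∧
        (∀ (f : Site θ.D → θ.𝔸) (r : ℝ), 0 ≤ r → Bd2 θ.L i.η i.k i.Ω f r →
          (∀ x, ‖g f x‖ ≤ BG * r) ∧ ∀ n, n ≤ i.k → ∀ p ∈ {b : Site θ.D × Fin θ.D | SideTouches (i.Ω n) b.1 b.2},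
            wt θ.L i.η n * ‖covDerivFwd i.η U₀ p.2 (g f) p.1‖ ≤ BG * r) ∧
        (∀ (f : Site θ.D → θ.𝔸) (r : ℝ), 0 ≤ r → Bd2 θ.L i.η i.k i.Ω f r → Bd2 θ.L i.η i.k i.Ω (f - g (qs (c (q (g f))))) (BR * r)))
    -- N06's FRAME for [4] Thm 3.3 (any index type, geometries, backgrounds, the two kernel families of Thms 3.1–3.3) and its `ℤᵈ` dictionary maps
    {I : Type} (geo : I → B9.Geometry) (bg : I → B9.Backgrounds) (Gp GA : ∀ i, B9.KernelFamily (geo i) (bg i))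
    (mem : ℝ → ZdIdx θ.D θ.L → ℕ → I)
    (ιCfg : ∀ (M : ℝ) (i : ZdIdx θ.D θ.L) (m : ℕ) (U₀ : Site θ.D → Fin θ.D → θ.𝔸ˣ), (∀ x κ, U₀ x κ ∈ unitaryUnits θ.𝔸) → (bg (mem M i m)).Cfg)
    (ιLoc : ∀ (M : ℝ) (i : ZdIdx θ.D θ.L) (m : ℕ), (Site θ.D → Fin θ.D → θ.𝔸) → (geo (mem M i m)).Loc)
    (ops : ℝ → ZdIdx θ.D θ.L → ℕ → OpsZd θ.D θ.𝔸)
    -- THE GENUINE AVERAGING LETTER: `ops` carries dag-n06-b's `withQQP` co-letter `(Q*Q)(U₀)` at print's class of the member ([4] (3.16); trace functional `τ`)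
    [FiniteDimensional ℝ θ.𝔸] (τ : θ.𝔸 →ₗ[ℂ] ℂ) {Cτ : ℝ} (hCτ : ∀ x y : θ.𝔸, |(τ (star x * y)).re| ≤ Cτ * ‖x‖ * ‖y‖)
    (ops₀ : ℝ → ZdIdx θ.D θ.L → ℕ → OpsZd θ.D θ.𝔸)
    (hops : ∀ (M : ℝ) (i : ZdIdx θ.D θ.L) (m : ℕ), ops M i m = withQQP τ θ.L (fun m' l => towerBondsP θ.L i.Ω (i.Λs m') l) ops₀ M i m)
    {c35 c₆ K₆ M₃ a₃ c69 β cS cSβ : ℝ} {CH : ℝ → ℝ} {len : Site θ.D → ℝ}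
    -- N06's THEOREM 3.3 AS PRINTED, by name
    (h33 : B9.Thm33Printed c35 geo bg Gp GA)
    -- dag-n06-b's JUNCTION DICTIONARY BINDERS at the (1.3)–(1.5)-admissible members, guarded (N06 object layer; HYPOTHESES) — NO `havg`
    (hdict : ∀ (M : ℝ) (j : IdxB8SubD θ) (m : ℕ), 1 ≤ M → M₃ ≤ M → m ≤ j.1.1.1.1.k → DictAt geo bg GA θ.L mem ιCfg ιLoc ops M j.1.1.1.1 m)
    (hP6 : ∀ (M : ℝ) (j : IdxB8SubD θ) (m : ℕ), 1 ≤ M → M₃ ≤ M → m ≤ j.1.1.1.1.k → Prop6At bg θ.L mem ιCfg c35 c₆ K₆ M j.1.1.1.1 m)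
    (hinv : ∀ (M : ℝ) (j : IdxB8SubD θ) (m : ℕ), 1 ≤ M → M₃ ≤ M → m ≤ j.1.1.1.1.k → InvAtH bg θ.L mem ιCfg ops c35 a₃ M j.1.1.1.1 m)
    (hcurv : ∀ (M : ℝ) (j : IdxB8SubD θ) (m : ℕ), 1 ≤ M → M₃ ≤ M → m ≤ j.1.1.1.1.k → CurvAtInAk θ.L ops c69 M j.1.1.1.1 m)
    (hlan : ∀ (M : ℝ) (j : IdxB8SubD θ) (m : ℕ), 1 ≤ M → M₃ ≤ M → m ≤ j.1.1.1.1.k → LandauAt bg θ.L mem ιCfg ops c35 a₃ M j.1.1.1.1 m)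
    (hhol : ∀ (M : ℝ) (j : IdxB8SubD θ) (m : ℕ), 1 ≤ M → M₃ ≤ M → m ≤ j.1.1.1.1.k → HolderAtδ2 geo bg GA θ.L mem ιCfg ops β len CH M j.1.1.1.1 m)
    (hlin : ∀ (M : ℝ) (j : IdxB8SubD θ) (m : ℕ), 1 ≤ M → M₃ ≤ M → m ≤ j.1.1.1.1.k → LinBddAt θ.L ops M j.1.1.1.1 m)
    (hsrc : ∀ (M : ℝ) (j : IdxB8SubD θ) (m : ℕ), 1 ≤ M → M₃ ≤ M → m ≤ j.1.1.1.1.k → SrcAt bg θ.L mem ιCfg ops c35 a₃ cS M j.1.1.1.1 m)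
    (hsrcH : ∀ (M : ℝ) (j : IdxB8SubD θ) (m : ℕ), 1 ≤ M → M₃ ≤ M → m ≤ j.1.1.1.1.k → SrcHolderAtδ2 bg θ.L mem ιCfg ops c35 a₃ β len cSβ M j.1.1.1.1 m)
    -- the junction's primitive constants ([4] (3.35)∕Prop. 6 `c₆ K₆`, (3.27) `a₃`, (3.69) `c69`, source `c_S c_Sβ`) and Theorem 8's source size factor `γ₈`
    (hc₆ : 0 < c₆) (hK₆ : 0 < K₆) (ha₃ : 0 < a₃) (hc69 : 0 ≤ c69) (hcS : 0 ≤ cS) (hcSβ : 0 ≤ cSβ) {γ₈ : ℝ} (hγ₈ : 1 ≤ γ₈) :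
    ∃ (lam : ResidB8 θ) (c₁ : ℝ) (ρ₀ : ℕ), B8LeafOfRecordSubBP₂D θ (lam.cutSubBP₅ c₁ ρ₀) := by
  have hL1 : 1 ≤ θ.L := le_trans (by norm_num) hL5
  refine exists_residB8_b8LeafOfRecordSubBP₂D_cutSubBP₅_of_letters_thm33_junctionH θ hD hL5 hB₀'H hB₂' hBG hBR hcL SLet SLetUB geo bg Gp GA mem ιCfg ιLoc ops
    (q := qQ θ.D θ.L Cτ (betaTau τ) 1) h33 hdict hP6 hinv hcurv hlan ?_ hhol hlin hsrc hsrcH hc₆ hK₆ ha₃ hc69 (qQ_one_nonneg' τ hL1 hCτ) hcS hcSβ hγ₈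
  -- `havg` DISCHARGED: the genuine letter's (3.16) bound at print's class, whose box law holds outright on `IdxB8SubD θ`
  intro M j m _ _ hm U₀ hU₀ A hOn j₀ hj₀ y μ ht
  rw [hops]
  exact avgAtP_withQQP τ θ.L hD θ.two_le_L hCτ _ ops₀ M j.1.1.1.1 m (IdxB8SubD.levelSepPP_towerBondsP j m hm) U₀ hU₀ A hOn j₀ hj₀ y μ ht

end WithQQP

end Summit.QuantumFields.YangMills.BalabanUVNodes.N05SubBP2DSlotExistsOfThm33JunctionHWithQQP

end
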